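import Summits.Ventures.CertifiedManyBodySolver.Rows.SourcedTorusRows
import Literature.MathematicalPhysics.QuantumLattice.PairFieldCommutatorLocality
import Literature.MathematicalPhysics.QuantumLattice.HubbardNNNHoppingPairCorrelatorCertificate
import HarnessLib

/-!
# PINNING-FIELD rows, part 2: the certificate hook and the one-point dictionary

HONEST FRAMING: first certified bounds on pairing observables; not a superconductivity verdict; every
number certified (two lineages + referee) or labelled float. A response AT FIXED `h > 0` is
symmetry-allowed and says nothing about spontaneous order.

Companion of `Rows/SourcedTorusRows.lean` (cell hubbard-cq, D-0082 (c) / LADDER row PC-a, seat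
hubbard-cq-obsth-1), which types the energy and observable cells of the `d`-wave pair-sourced `t–t'`
Hubbard tori `A_L = dWaveSourceTorusTT' L tp U μ h`. Here:

* §2b HOOK `SourcedTorusCorrLowerRow.of_torus_certificate`: a torus identity
  `Γ Xw − c·1 − κ (u·1 − E_loc) = SOS + Σ[A_L, Xₖ] + Σ(U_{w}D_{γ} Y (U_{w}D_{γ})ᴴ − Y) + Σ(S^z W − W S^z)
   + Σ d(Vᴴ − V) + Σ a M` (translates of `E_loc` summing to `A_L`, labels in `ker χ_{B₁g}`, `κ ≥ 0`,
  `r ≤ c − Σ‖aₖ‖`) instantiates the below-cap LOWER cell — the tree soundness theorem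
  `dWaveSourceTorusTT'_re_orbitState_ge_of_local_certificate_ineq_of_energy_le` with no density rows, no
  sector-ideal rows (the particle number is not a charge of the sourced problem) and `S^z` as the one
  admissible charge.
* §3 DICTIONARY: the window one-point pair word `onePointPairWord = Φ₀ + Φ₀ᴴ`
  (`Φ₀ = localPairAt {0,±e₁,±e₂} dWaveFormFactor 0`); `Σ_w U_w Γ(Φ₀) U_wᴴ = Δ_d`;
  `L² · ω̄_ψ(X) = ⟨ψ, (Σ_w U_w X U_wᴴ) ψ⟩` for the translation family (`S = {1}`); hence
  `Re ω̄_ψ(Γ(Φ₀ + Φ₀ᴴ)) = Re ⟨ψ, (Δ_d + Δ_dᴴ) ψ⟩ / L²` and the one-point ground-state cells UNFOLD onto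
  `r · L² ≤ Re ⟨ψ, (Δ_d + Δ_dᴴ) ψ⟩` (resp. `≤`) for every unit `S^z`-eigenvector ground state of `A_L`
  (`SourcedTorusCorrLowerRowGS.onePoint_iff`, `…UpperRowGS.onePoint_iff`) — exactly the quantity the
  sourced-energy chords bracket (`DWaveSourceProofs`: `(h' − h)·⟨O⟩_h ≤ E(h) − E(h')`; seat obsth-3).

Everything is PROVED; the only definition is the word `onePointPairWord`; no named fact, no `sorry`.
The file-local `DecidableEq (FermionTorus 2 L)` instance is the one of `SourcedTorusRows.lean` and of the
tree soundness files (torus sites compared through the linear order).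

References: T. Koma, H. Tasaki, J. Stat. Phys. 76 (1994) 745, §1; J. Wang et al., PRX 14 (2024) 031006,
§III; X. Han, arXiv:2006.06002, §3; D. J. Scalapino, Phys. Rep. 250 (1995) 329, §2 eq. (2.2)–(2.3).
-/

noncomputable section

namespace Summit.Ventures.CertifiedManyBodySolver

open Literature.MathematicalPhysics.QuantumLattice
open Matrix HubbardWave0 Literature.Probability.LatticeModels Finset
open Literature.MathematicalPhysics.QuantumManyBody.StateRelaxation
open scoped BigOperators ComplexOrder

/-- (Local to this file, as in `SourcedTorusRows.lean` and the tree's torus soundness files: torus sites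
are compared through the linear order, so that the cells, the soundness theorem and the
`fermionEmbed_toTorusEmb_*` dictionary agree literally.) -/
local instance (priority := high) instDecidableEqFermionTorusSourcedRowsHook {L : ℕ} :
    DecidableEq (FermionTorus 2 L) :=
  LinearOrder.toDecidableEq

/-! ## §2b  The certificate hook: a torus identity instantiates the below-cap cell -/

section Hook

variable {L : ℕ} [NeZero L]

/-- **The below-cap LOWER cell from a torus certificate** (tree
`dWaveSourceTorusTT'_re_orbitState_ge_of_local_certificate_ineq_of_energy_le` with NO density rows and NO
sector-ideal rows — the particle number is not a charge of the sourced problem — and `S^z` as the one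
admissible charge): an identity on the torus of side `L`
`Γ Xw − c·1 − κ (u·1 − E_loc) = Σ Λₐᵦ Oₐᴴ O_b + (Σₖ (A Xₖ − Xₖ A) + Σₗ (U_{wₗ}D_{γₗ} Yₗ (U_{wₗ}D_{γₗ})ᴴ − Yₗ)
  + Σⱼ (S^z Wⱼ − Wⱼ S^z)) + (Σₘ dₘ (Vₘᴴ − Vₘ) + Σₖ aₖ Mₖ)`
with `Λ ⪰ 0`, `κ ≥ 0`, the translates of `E_loc` summing to `A_L`, labels `γₗ ∈ S ⊆ ker χ_{B₁g}`
(`1 ∈ S`, closed under products), contractions `Mₖ`, and a slot `r ≤ c − Σ‖aₖ‖`, gives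
`SourcedTorusCorrLowerRow L tp U μ h u r Λ' hInj' S Xw`. -/
theorem SourcedTorusCorrLowerRow.of_torus_certificate (tp U μ h : ℝ) {u r : ℚ}
    {S : Finset (DihedralGroup 4)} (h1 : (1 : DihedralGroup 4) ∈ S) (hmul : ∀ a ∈ S, ∀ b ∈ S, a * b ∈ S)
    (hS : ∀ γ ∈ S, b1gChar γ = 1) {Λ' : Finset (Site 2)} (hInj' : Set.InjOn (Torus.proj (d := 2) L) ↑Λ')
    (Xw : FermionOp Λ')
    (Eloc : Matrix (Finset (Orb (FermionTorus 2 L))) (Finset (Orb (FermionTorus 2 L))) ℂ)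
    (hE : ∑ v : TorusSite 2 L, (fockTranslate v).val * Eloc * (fockTranslate v).valᴴ =
      dWaveSourceTorusTT' L tp U μ h) {κ : ℝ} (hκ : 0 ≤ κ)
    {m : Type*} [Fintype m] [DecidableEq m] {Λm : Matrix m m ℂ} (hΛ : Λm.PosSemidef)
    (O : m → Matrix (Finset (Orb (FermionTorus 2 L))) (Finset (Orb (FermionTorus 2 L))) ℂ)
    {κ' : Type*} (s : Finset κ')
    (Xc : κ' → Matrix (Finset (Orb (FermionTorus 2 L))) (Finset (Orb (FermionTorus 2 L))) ℂ)
    {ι : Type*} (tt : Finset ι) (γ : ι → DihedralGroup 4) (hγS : ∀ l ∈ tt, γ l ∈ S)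
    (wv : ι → TorusSite 2 L)
    (Y : ι → Matrix (Finset (Orb (FermionTorus 2 L))) (Finset (Orb (FermionTorus 2 L))) ℂ)
    {γ' : Type*} (u' : Finset γ')
    (W : γ' → Matrix (Finset (Orb (FermionTorus 2 L))) (Finset (Orb (FermionTorus 2 L))) ℂ)
    {δ : Type*} (ah : Finset δ) (dc : δ → ℝ)
    (V : δ → Matrix (Finset (Orb (FermionTorus 2 L))) (Finset (Orb (FermionTorus 2 L))) ℂ)
    {κ'' : Type*} (w : Finset κ'') (a : κ'' → ℂ)
    (Mw : κ'' → Matrix (Finset (Orb (FermionTorus 2 L))) (Finset (Orb (FermionTorus 2 L))) ℂ)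
    (hM : ∀ k ∈ w, (Mw k).IsContraction) {c : ℝ}
    (hcert : fermionEmbed (PolySite.toTorusEmb L hInj') Xw -
        (c : ℂ) • (1 : Matrix (Finset (Orb (FermionTorus 2 L))) (Finset (Orb (FermionTorus 2 L))) ℂ) -
        ((κ : ℝ) : ℂ) • ((((u : ℚ) : ℝ) : ℂ) •
          (1 : Matrix (Finset (Orb (FermionTorus 2 L))) (Finset (Orb (FermionTorus 2 L))) ℂ) - Eloc) =
      gramForm Λm O +
        (∑ k ∈ s, (dWaveSourceTorusTT' L tp U μ h * Xc k - Xc k * dWaveSourceTorusTT' L tp U μ h) +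
          ∑ l ∈ tt, ((fockTranslate (wv l)).val * (fockD4 (L := L) (γ l)).val * Y l *
              ((fockTranslate (wv l)).val * (fockD4 (L := L) (γ l)).val)ᴴ - Y l) +
          ∑ j ∈ u', (HubbardWave0.spinZ * W j - W j * HubbardWave0.spinZ)) +
        (∑ m' ∈ ah, ((dc m' : ℝ) : ℂ) • ((V m')ᴴ - V m') + ∑ k ∈ w, a k • Mw k))
    (hr : ((r : ℚ) : ℝ) ≤ c - ∑ k ∈ w, ‖a k‖) :
    SourcedTorusCorrLowerRow L tp U μ h u r Λ' hInj' S Xw := by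
  intro M E ψ hψ hψ1 hHψ hEu
  -- rewrite the identity into the shape of the tree theorem (empty density and sector-ideal families)
  have hcert' : fermionEmbed (PolySite.toTorusEmb L hInj') Xw -
        (c : ℂ) • (1 : Matrix (Finset (Orb (FermionTorus 2 L))) (Finset (Orb (FermionTorus 2 L))) ℂ) -
        ∑ i ∈ (∅ : Finset (Fin 0)), (((0 : ℝ) : ℝ) : ℂ) • ((0 : Matrix _ _ ℂ) - (((0 : ℝ) : ℝ) : ℂ) •
          (1 : Matrix (Finset (Orb (FermionTorus 2 L))) (Finset (Orb (FermionTorus 2 L))) ℂ)) -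
        ((κ : ℝ) : ℂ) • ((((u : ℚ) : ℝ) : ℂ) •
          (1 : Matrix (Finset (Orb (FermionTorus 2 L))) (Finset (Orb (FermionTorus 2 L))) ℂ) - Eloc) =
      gramForm Λm O +
        (∑ k ∈ s, (dWaveSourceTorusTT' L tp U μ h * Xc k - Xc k * dWaveSourceTorusTT' L tp U μ h) +
          ∑ l ∈ tt, ((fockTranslate (wv l)).val * (fockD4 (L := L) (γ l)).val * Y l *
              ((fockTranslate (wv l)).val * (fockD4 (L := L) (γ l)).val)ᴴ - Y l) +
          ∑ i ∈ (∅ : Finset (Fin 0)), ((0 : Matrix _ _ ℂ) * ((0 : Matrix _ _ ℂ) - (((0 : ℝ) : ℝ) : ℂ) • 1) +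
            ((0 : Matrix _ _ ℂ) - (((0 : ℝ) : ℝ) : ℂ) • 1) * (0 : Matrix _ _ ℂ)) +
          ∑ j ∈ u', ((fun _ => HubbardWave0.spinZ) j * W j - W j * (fun _ => HubbardWave0.spinZ) j)) +
        (∑ m' ∈ ah, ((dc m' : ℝ) : ℂ) • ((V m')ᴴ - V m') + ∑ k ∈ w, a k • Mw k) := by
    rw [Finset.sum_empty, Finset.sum_empty, sub_zero, add_zero]
    exact hcert
  have hmain := dWaveSourceTorusTT'_re_orbitState_ge_of_local_certificate_ineq_of_energy_le tp U μ h h1 hmul hS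
    hψ hψ1 hHψ (fermionEmbed (PolySite.toTorusEmb L hInj') Xw) Eloc hE hκ hEu
    (∅ : Finset (Fin 0)) (fun _ => 0) (fun _ => 0) (fun _ => 0) (fun _ => 0) (fun _ => 0)
    (fun i hi => absurd hi (Finset.notMem_empty i)) (fun i hi => absurd hi (Finset.notMem_empty i))
    hΛ O s Xc tt γ hγS wv Y
    (∅ : Finset (Fin 0)) (fun _ => 0) (fun _ => 0) (fun _ => 0) (fun _ => 0)
    (fun i hi => absurd hi (Finset.notMem_empty i)) (fun i hi => absurd hi (Finset.notMem_empty i))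
    u' (fun _ => HubbardWave0.spinZ) W (fun _ => M) (fun _ _ => HubbardWave0.spinZ_isHermitian)
    (fun _ _ φ hφ => spinZ_mulVec_of_mem_fockSpinZSector hφ) ah dc V w a Mw hM hcert'
  rw [Finset.sum_empty, add_zero] at hmain
  exact hr.trans hmain

end Hook

/-! ## §3  Dictionary: the one-point pair word and the translation-averaged state -/

section OnePoint

/-- The window ONE-POINT pair word `Φ₀ + Φ₀ᴴ` on the pair region `{0} ∪ ({0} + S_d)`, `S_d = {0, ±e₁, ±e₂}`,
`Φ₀ = localPairAt S_d dWaveFormFactor 0 = Σ_e (g_d(e)/√2)(c_{0↑}c_{e↓} − c_{0↓}c_{e↑})` (the tree word whose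
translates carry the pinning term of `dWaveSourceTorus[TT']`, `sum_conj_fockTranslate_pairSourceObjective`).
Its sourced ground-state expectation per site is Koma–Tasaki's response `ω_h(O_Λ)/|Λ|`, `O = Δ_d + Δ_d†`. -/
def onePointPairWord : FermionOp (pairRegion (insert (0 : Site 2) unitSteps) 0) :=
  localPairAt (insert (0 : Site 2) unitSteps) dWaveFormFactor 0 +
    (localPairAt (insert (0 : Site 2) unitSteps) dWaveFormFactor 0)ᴴ

variable {L : ℕ} [NeZero L]

/-- **The translates of the pulled-back local pair sum to the pair field**: `Σ_w U_w Γ(Φ₀) U_wᴴ = Δ_d`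
(`pairField_eq_sum_relabel_translate`). -/
theorem sum_conj_fockTranslate_fermionEmbed_localPairAt (g : Site 2 → ℝ)
    (hInj : Set.InjOn (Torus.proj (d := 2) L) ↑(pairRegion (insert (0 : Site 2) unitSteps) 0)) :
    ∑ w : TorusSite 2 L, (fockTranslate w).val *
        fermionEmbed (PolySite.toTorusEmb L hInj) (localPairAt (insert (0 : Site 2) unitSteps) g 0) *
        (fockTranslate w).valᴴ = pairField g L := by
  rw [pairField_eq_sum_relabel_translate g L hInj]
  exact Finset.sum_congr rfl fun w _ => (relabel_eq_fockRelabel_conj _ _).symm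

/-- `Σ_w U_w Γ(Φ₀ + Φ₀ᴴ) U_wᴴ = Δ_d + Δ_dᴴ` (the Hermitian order operator `O` of Koma–Tasaki). -/
theorem sum_conj_fockTranslate_fermionEmbed_onePointPairWord
    (hInj : Set.InjOn (Torus.proj (d := 2) L) ↑(pairRegion (insert (0 : Site 2) unitSteps) 0)) :
    ∑ w : TorusSite 2 L, (fockTranslate w).val * fermionEmbed (PolySite.toTorusEmb L hInj) onePointPairWord *
        (fockTranslate w).valᴴ = pairField dWaveFormFactor L + (pairField dWaveFormFactor L)ᴴ := by
  have h1 := sum_conj_fockTranslate_fermionEmbed_localPairAt (L := L) dWaveFormFactor hInj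
  have h2 : ∑ w : TorusSite 2 L, (fockTranslate w).val *
      (fermionEmbed (PolySite.toTorusEmb L hInj) (localPairAt (insert (0 : Site 2) unitSteps) dWaveFormFactor 0))ᴴ *
      (fockTranslate w).valᴴ = (pairField dWaveFormFactor L)ᴴ := by
    rw [← h1, conjTranspose_sum]
    refine Finset.sum_congr rfl fun w _ => ?_
    rw [conjTranspose_mul, conjTranspose_mul, conjTranspose_conjTranspose, Matrix.mul_assoc]
  rw [onePointPairWord, map_add, fermionEmbed_conjTranspose]
  simp only [Matrix.mul_add, Matrix.add_mul, Finset.sum_add_distrib]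
  rw [h1, h2]

/-- **The translation-averaged vector state is the normalised torus sum**: for `S = {1}`,
`L² · ω̄_ψ(X) = ⟨ψ, (Σ_w U_w X U_wᴴ) ψ⟩`. -/
theorem sq_mul_orbitState_singleton_one_eq (ψ : Fock (Orb (FermionTorus 2 L)))
    (X : Matrix (Finset (Orb (FermionTorus 2 L))) (Finset (Orb (FermionTorus 2 L))) ℂ) :
    ((L ^ 2 : ℕ) : ℂ) * orbitState (spaceGroupUnitary ({1} : Finset (DihedralGroup 4))) ψ X =
      star ψ ⬝ᵥ ((∑ w : TorusSite 2 L, (fockTranslate w).val * X * (fockTranslate w).valᴴ) *ᵥ ψ) := by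
  rw [← sum_spaceGroupUnitary_singleton_one_conj, star_dotProduct_sum_spaceGroup_conj_mulVec (Finset.mem_singleton_self _),
    Finset.card_singleton, mul_one]

/-- **The one-point cell's observable is Koma–Tasaki's response per site**:
`Re ω̄_ψ(Γ(Φ₀ + Φ₀ᴴ)) = Re ⟨ψ, (Δ_d + Δ_dᴴ) ψ⟩ / L²` (`S = {1}`). -/
theorem re_orbitState_onePointPairWord_eq_div (ψ : Fock (Orb (FermionTorus 2 L)))
    (hInj : Set.InjOn (Torus.proj (d := 2) L) ↑(pairRegion (insert (0 : Site 2) unitSteps) 0)) :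
    (orbitState (spaceGroupUnitary ({1} : Finset (DihedralGroup 4))) ψ
        (fermionEmbed (PolySite.toTorusEmb L hInj) onePointPairWord)).re =
      (star ψ ⬝ᵥ ((pairField dWaveFormFactor L + (pairField dWaveFormFactor L)ᴴ) *ᵥ ψ)).re / (L : ℝ) ^ 2 := by
  have hLr : ((L : ℝ)) ^ 2 ≠ 0 := pow_ne_zero 2 (Nat.cast_ne_zero.2 (NeZero.ne L))
  rw [← sum_conj_fockTranslate_fermionEmbed_onePointPairWord hInj, ← sq_mul_orbitState_singleton_one_eq]
  have hc : ((L ^ 2 : ℕ) : ℂ) = ((((L : ℝ)) ^ 2 : ℝ) : ℂ) := by push_cast; ring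
  rw [hc, Complex.re_ofReal_mul, mul_div_cancel_left₀ _ hLr]

/-- **The one-point ground-state LOWER cell, unfolded onto the torus response**:
`SourcedTorusCorrLowerRowGS L tp U μ h r _ hInj {1} onePointPairWord` says exactly that
`r · L² ≤ Re ⟨ψ, (Δ_d + Δ_dᴴ) ψ⟩` for every unit ground-state vector `ψ` of `A_L` with `S^z ψ = M ψ` —
the quantity a Hellmann–Feynman / energy-chord bracket bounds (`(h' − h)⟨O⟩_h ≤ E(h) − E(h')`). -/
theorem SourcedTorusCorrLowerRowGS.onePoint_iff {tp U μ h : ℝ} {r : ℚ}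
    (hInj : Set.InjOn (Torus.proj (d := 2) L) ↑(pairRegion (insert (0 : Site 2) unitSteps) 0)) :
    SourcedTorusCorrLowerRowGS L tp U μ h r _ hInj ({1} : Finset (DihedralGroup 4)) onePointPairWord ↔
      ∀ (M : ℝ) (ψ : Fock (Orb (FermionTorus 2 L))), ψ ∈ fockSpinZSector (Λ := FermionTorus 2 L) M →
        star ψ ⬝ᵥ ψ = 1 → (dWaveSourceTorusTT' L tp U μ h).IsGroundStateVector ψ →
        ((r : ℚ) : ℝ) * (L : ℝ) ^ 2 ≤
          (star ψ ⬝ᵥ ((pairField dWaveFormFactor L + (pairField dWaveFormFactor L)ᴴ) *ᵥ ψ)).re := by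
  have hL : (0 : ℝ) < (L : ℝ) ^ 2 := by
    have : (0 : ℝ) < (L : ℝ) := by exact_mod_cast Nat.pos_of_ne_zero (NeZero.ne L)
    positivity
  refine ⟨fun hrow M ψ hψ h1 hgs => ?_, fun hrow M ψ hψ h1 hgs => ?_⟩
  · have h := hrow M ψ hψ h1 hgs
    rw [re_orbitState_onePointPairWord_eq_div ψ hInj, le_div_iff₀ hL] at h
    exact h
  · rw [re_orbitState_onePointPairWord_eq_div ψ hInj, le_div_iff₀ hL]
    exact hrow M ψ hψ h1 hgs

/-- The UPPER twin of `SourcedTorusCorrLowerRowGS.onePoint_iff`: `Re ⟨ψ, (Δ_d + Δ_dᴴ) ψ⟩ ≤ r · L²`. -/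
theorem SourcedTorusCorrUpperRowGS.onePoint_iff {tp U μ h : ℝ} {r : ℚ}
    (hInj : Set.InjOn (Torus.proj (d := 2) L) ↑(pairRegion (insert (0 : Site 2) unitSteps) 0)) :
    SourcedTorusCorrUpperRowGS L tp U μ h r _ hInj ({1} : Finset (DihedralGroup 4)) onePointPairWord ↔
      ∀ (M : ℝ) (ψ : Fock (Orb (FermionTorus 2 L))), ψ ∈ fockSpinZSector (Λ := FermionTorus 2 L) M →
        star ψ ⬝ᵥ ψ = 1 → (dWaveSourceTorusTT' L tp U μ h).IsGroundStateVector ψ →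
        (star ψ ⬝ᵥ ((pairField dWaveFormFactor L + (pairField dWaveFormFactor L)ᴴ) *ᵥ ψ)).re ≤
          ((r : ℚ) : ℝ) * (L : ℝ) ^ 2 := by
  have hL : (0 : ℝ) < (L : ℝ) ^ 2 := by
    have : (0 : ℝ) < (L : ℝ) := by exact_mod_cast Nat.pos_of_ne_zero (NeZero.ne L)
    positivity
  refine ⟨fun hrow M ψ hψ h1 hgs => ?_, fun hrow M ψ hψ h1 hgs => ?_⟩
  · have h := hrow M ψ hψ h1 hgs
    rw [re_orbitState_onePointPairWord_eq_div ψ hInj, div_le_iff₀ hL] at h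
    exact h
  · rw [re_orbitState_onePointPairWord_eq_div ψ hInj, div_le_iff₀ hL]
    exact hrow M ψ hψ h1 hgs

end OnePoint

end Summit.Ventures.CertifiedManyBodySolver

end
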